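import Literature.AlgebraicGeometry.RelativeSpec.FreeQuotient
import Literature.RingTheory.GaloisAlgebras.ChaseHarrisonRosenbergEtale
import Mathlib.AlgebraicGeometry.Morphisms.Etale
import HarnessLib

/-!
# Quotients by free actions of finite groups: `X → X/G` is étale (SGA 1, Exp. V, §2)

Continuation of `Literature.AlgebraicGeometry.RelativeSpec.FreeQuotient` (`π : X → X/G` finite,
flat, surjective for a FREE action — on every `Γ(X, r⁻¹U)`, `U ⊆ Y` affine open, and every
`g ≠ 1`, the `g • b - b` generate the unit ideal). With the ring-theoretic input
`Literature.RingTheory.GaloisAlgebras.etale_of_free` (a Galois extension of commutative rings in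
the sense of Chase–Harrison–Rosenberg is étale: torsor isomorphism `B ⊗_A B ≅ ∏_G B` plus étale
descent along the faithfully flat `A → B`), the same chart argument gives:

* `ActionOver.etale_toQuotient` — **for a free action, `π : X ⟶ X/G` is étale** (SGA 1, Exp. V,
  Cor. 2.4 / Prop. 2.6: `X → X/G` is étale at the points with trivial inertia, in particular an
  étale `G`-torsor when `G` acts freely; Mumford, *Abelian Varieties*, §7, Thm. p. 66 and §12).

Everything is proved; no named facts.

## References

* A. Grothendieck, *SGA 1*, Exp. V, §2, Cor. 2.4, Prop. 2.6. [SGA1]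
* D. Mumford, *Abelian Varieties* (1970), §7, Thm. p. 66; §12. [MumfordAV1970]
* C. Greither, LNM 1534, Ch. 0, Thm. 1.6. [Greither1992CyclicGalois]
-/

noncomputable section

universe u

open CategoryTheory Limits AlgebraicGeometry

namespace Literature.AlgebraicGeometry.RelativeSpec

namespace ActionOver

variable {X Y : Scheme.{u}} {r : X ⟶ Y} {G : Type*} [Group G] (ρ : ActionOver r G)

/-- **Free action ⇒ `Γ(X, r⁻¹U)` is étale over its invariants** (Chase–Harrison–Rosenberg +
étale descent, `Literature.RingTheory.GaloisAlgebras.etale_of_free`).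
[cite: SGA1, Exp. V, Prop. 2.6] -/
theorem etale_subtype_of_free [Finite G] (U : Y.Opens)
    (hfree : ∀ g : G, g ≠ 1 →
      Ideal.span (Set.range fun b : Γ(X, r ⁻¹ᵁ U) ↦ ρ.act g U b - b) = ⊤) :
    (ρ.invariantsRing U).subtype.Etale := by
  letI := ρ.mulSemiringAction U
  let _ : Fintype G := Fintype.ofFinite G
  haveI := ρ.isInvariant_invariantsRing U
  haveI := ρ.faithfulSMul_invariantsRing U
  have h : Algebra.Etale (ρ.invariantsRing U) Γ(X, r ⁻¹ᵁ U) :=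
    Literature.RingTheory.GaloisAlgebras.etale_of_free (ρ.invariantsRing U) G hfree
  exact RingHom.etale_algebraMap.mpr h

variable [Finite G] [IsAffineHom r]
  (hfree : ∀ (U : Y.affineOpens) (g : G), g ≠ 1 →
    Ideal.span (Set.range fun b : Γ(X, r ⁻¹ᵁ U) ↦ ρ.act g U b - b) = ⊤)
include hfree

/-- **For a free action, `π : X ⟶ X/G` is étale** (SGA 1, Exp. V, Cor. 2.4 and Prop. 2.6: the
quotient map is étale at every point with trivial inertia group, so a free action gives an étale
`G`-torsor; Mumford, *Abelian Varieties*, §7 and §12): on the affine chart over `U ⊆ Y`, `π` is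
`Spec` of the inclusion `Γ(X, r⁻¹U)^G ⊆ Γ(X, r⁻¹U)`, which is étale by Chase–Harrison–Rosenberg
and étale descent (`etale_subtype_of_free`). [cite: SGA1, Exp. V, Prop. 2.6] -/
theorem etale_toQuotient : Etale ρ.toQuotient :=
  ρ.invariants.toSpec_of_forall_specMap @Etale fun U ↦
    (HasRingHomProperty.Spec_iff (P := @Etale)).mpr (ρ.etale_subtype_of_free U.1 (hfree U))

/-- For a free action `π : X ⟶ X/G` is finite étale and surjective: an étale `G`-torsor
(`isFinite_toQuotient`, `etale_toQuotient`, `surjective_toQuotient`). [cite: SGA1, Exp. V, Prop. 2.6] -/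
theorem isFinite_and_etale_toQuotient :
    IsFinite ρ.toQuotient ∧ Etale ρ.toQuotient ∧ Surjective ρ.toQuotient :=
  ⟨ρ.isFinite_toQuotient hfree, ρ.etale_toQuotient hfree, ρ.surjective_toQuotient hfree⟩

end ActionOver

end Literature.AlgebraicGeometry.RelativeSpec

end
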